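import Literature.NumberTheory.ConnesMoscovici2022.UVProlateEigenWronskian
import Literature.NumberTheory.ConnesMoscovici2022.UVProlateNegativeEigenInterior
import Mathlib.Analysis.ODE.Gronwall
import HarnessLib

/-!
# Connes–Moscovici 2022, Thm 5.1 (first clause): negative even-sector eigenvalues of `W_sa` are simple

Topic `Literature/NumberTheory/ConnesMoscovici2022`.  The named fact `CM22_thm_5_1` (`λ = √2`) opens
with "every negative even-sector eigenvalue is simple" (`finrank (eigenspace μ ⊓ evenPart) ≤ 1`).  We
PROVE this clause for EVERY `λ > 0` (`finrank_eigenspace_inf_evenPart_le_one`), from: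
* the vanishing of the Wronskian of two eigen-representatives on `(λ, ∞)`
  (`UVProlateEigenWronskian.lean`);
* the interior vanishing of a.e.-even eigenfunctions with `μ < 0` on `(−λ, λ)`
  (`UVProlateNegativeEigenInterior.lean`);
* uniqueness for the linear system `(h, p h′)′ = (p h′/p, (q − μ) h)` on compact subintervals of
  `(λ, ∞)` (Mathlib `ODE_solution_unique_of_mem_Icc_right/left`): zero Cauchy data at one point
  `x₁ > λ` force `h ≡ 0` on `(λ, ∞)` (`eq_zero_Ioi_of_prolate_ode`).
Hence two a.e.-even eigenvectors with the same `μ < 0` are proportional (`exists_smul_eq_of_eigen`).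
RH-FREE; the remaining clauses of Thm 5.1 (finite multiplicity windows, the counting asymptotics) are
not addressed; nothing here bears on the truth of RH.
-/

noncomputable section

open Complex Set MeasureTheory Filter Topology
open scoped Real Topology ContDiff NNReal

namespace Literature.NumberTheory.ConnesMoscovici2022

open Literature.NumberTheory.ConnesConsani2021 Literature.NumberTheory.ConnesConsani2024

variable {lam : ℝ}

/-- `S = ℝ ∖ {±λ}` is open (plumbing). [folklore] -/
private theorem isOpen_S3 (lam : ℝ) : IsOpen {x : ℝ | x ≠ lam ∧ x ≠ -lam} := isOpen_ne.and isOpen_ne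

/-- **Uniqueness for the prolate equation on `(λ, ∞)`**: a function smooth off `±λ` with
`(p h′)′ = (q − μ) h` and zero Cauchy data `h(x₁) = h′(x₁) = 0` at some `x₁ > λ` vanishes on `(λ, ∞)`
(Picard–Lindelöf uniqueness for the first-order system in `(h, p h′)`, `p ≠ 0` there).
[cite: ConnesMoscovici2022, Thm 5.1 "discrete simple spectrum" (= arXiv:2112.05500 Thm 6.1, chunk p0011:L6); §1 (1.1)] -/
theorem eq_zero_Ioi_of_prolate_ode (hlam : 0 < lam) (μ : ℝ) {h : ℝ → ℂ}
    (hsm : ContDiffOn ℝ ∞ h {x | x ≠ lam ∧ x ≠ -lam})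
    (hu : ∀ x ∈ {x : ℝ | x ≠ lam ∧ x ≠ -lam},
      HasDerivAt (fun y => pCoeff lam y * deriv h y) ((qCoeff lam x - μ) * h x) x)
    {x₁ : ℝ} (hx₁ : lam < x₁) (h0 : h x₁ = 0) (h0' : deriv h x₁ = 0) :
    ∀ x ∈ Ioi lam, h x = 0 := by
  have hS := isOpen_S3 lam
  have hIoi : Ioi lam ⊆ {x : ℝ | x ≠ lam ∧ x ≠ -lam} := fun x hx =>
    ⟨ne_of_gt hx, by intro h; rw [h] at hx; exact absurd hx (by simp; linarith)⟩
  have hgd : ∀ x ∈ {x : ℝ | x ≠ lam ∧ x ≠ -lam}, HasDerivAt h (deriv h x) x := fun x hx =>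
    ((hsm.differentiableOn (by simp) x hx).differentiableAt (hS.mem_nhds hx)).hasDerivAt
  have hd1 : ContDiffOn ℝ 1 (deriv h) {x : ℝ | x ≠ lam ∧ x ≠ -lam} := hsm.deriv_of_isOpen hS (by norm_cast)
  intro x hx
  -- work on [a, b] with a = min x x₁, b = max x x₁
  set a : ℝ := min x x₁ with ha
  set b : ℝ := max x x₁ with hb
  have hla : lam < a := lt_min hx hx₁
  have hab : a ≤ b := min_le_max
  have hIcc : Icc a b ⊆ Ioi lam := fun t ht => lt_of_lt_of_le hla ht.1
  -- the vector field and its Lipschitz constant on [a, b]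
  set v : ℝ → ℂ × ℂ → ℂ × ℂ := fun t y => (y.2 / pCoeff lam t, (qCoeff lam t - μ) * y.1) with hv
  have hp_lower : ∀ t ∈ Icc a b, a ^ 2 - lam ^ 2 ≤ ‖pCoeff lam t‖ := by
    intro t ht
    have hlt : lam < t := hIcc ht
    rw [pCoeff, Complex.norm_real, Real.norm_eq_abs, abs_of_nonpos (by nlinarith), neg_sub]
    nlinarith [ht.1, hla]
  have hpa : 0 < a ^ 2 - lam ^ 2 := by nlinarith
  have hq_upper : ∀ t ∈ Icc a b, ‖qCoeff lam t - (μ : ℂ)‖ ≤ (2 * π * lam) ^ 2 * b ^ 2 + |μ| := by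
    intro t ht
    have ht0 : 0 ≤ t := (hlam.trans (hIcc ht)).le
    calc ‖qCoeff lam t - (μ : ℂ)‖ ≤ ‖qCoeff lam t‖ + ‖(μ : ℂ)‖ := norm_sub_le _ _
      _ = (2 * π * lam) ^ 2 * t ^ 2 + |μ| := by
          rw [qCoeff, Complex.norm_real, Complex.norm_real, Real.norm_eq_abs, Real.norm_eq_abs,
            abs_of_nonneg (by positivity)]
      _ ≤ (2 * π * lam) ^ 2 * b ^ 2 + |μ| := by
          gcongr
          exact ht.2
  set Kr : ℝ := max (1 / (a ^ 2 - lam ^ 2)) ((2 * π * lam) ^ 2 * b ^ 2 + |μ|) with hKr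
  have hKr0 : 0 ≤ Kr := le_max_of_le_left (by positivity)
  have hLip : ∀ t ∈ Icc a b, LipschitzOnWith (Real.toNNReal Kr) (v t) univ := by
    intro t ht
    refine LipschitzOnWith.of_dist_le_mul fun y _ y' _ => ?_
    rw [Real.coe_toNNReal _ hKr0]
    have hpt : 0 < ‖pCoeff lam t‖ := lt_of_lt_of_le hpa (hp_lower t ht)
    rw [dist_eq_norm, dist_eq_norm, hv]
    dsimp only
    rw [Prod.norm_def]
    simp only [Prod.fst_sub, Prod.snd_sub]
    refine max_le ?_ ?_
    · rw [← sub_div, norm_div]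
      calc ‖y.2 - y'.2‖ / ‖pCoeff lam t‖ ≤ ‖y.2 - y'.2‖ / (a ^ 2 - lam ^ 2) :=
            div_le_div_of_nonneg_left (norm_nonneg _) hpa (hp_lower t ht)
        _ = 1 / (a ^ 2 - lam ^ 2) * ‖y.2 - y'.2‖ := by ring
        _ ≤ Kr * ‖y - y'‖ := by
            refine mul_le_mul (le_max_left _ _) ?_ (norm_nonneg _) hKr0
            rw [Prod.norm_def]; exact le_max_right _ _
    · rw [← mul_sub, norm_mul]
      calc ‖qCoeff lam t - (μ : ℂ)‖ * ‖y.1 - y'.1‖ ≤ ((2 * π * lam) ^ 2 * b ^ 2 + |μ|) * ‖y.1 - y'.1‖ :=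
            mul_le_mul_of_nonneg_right (hq_upper t ht) (norm_nonneg _)
        _ ≤ Kr * ‖y - y'‖ := by
            refine mul_le_mul (le_max_right _ _) ?_ (norm_nonneg _) hKr0
            rw [Prod.norm_def]; exact le_max_left _ _
  -- the solution Y = (h, p h′) and the zero solution
  set Y : ℝ → ℂ × ℂ := fun t => (h t, pCoeff lam t * deriv h t) with hY
  have hYc : ContinuousOn Y (Icc a b) := by
    have hS' : Icc a b ⊆ {x : ℝ | x ≠ lam ∧ x ≠ -lam} := fun t ht => hIoi (hIcc ht)
    refine (hsm.continuousOn.mono hS').prodMk ?_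
    exact ((Complex.continuous_ofReal.comp (by fun_prop : Continuous fun t : ℝ => lam ^ 2 - t ^ 2)).continuousOn.mul
      (hd1.continuousOn.mono hS'))
  have hYd : ∀ t ∈ Icc a b, HasDerivAt Y (v t (Y t)) t := by
    intro t ht
    have htS := hIoi (hIcc ht)
    have hpt : pCoeff lam t ≠ 0 := norm_pos_iff.1 (lt_of_lt_of_le hpa (hp_lower t ht))
    have h1 : HasDerivAt h ((Y t).2 / pCoeff lam t) t := by
      refine (hgd t htS).congr_deriv ?_
      rw [hY]; dsimp only; field_simp
    have h2 : HasDerivAt (fun y => pCoeff lam y * deriv h y) ((qCoeff lam t - μ) * (Y t).1) t := hu t htS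
    exact h1.prodMk h2
  have hZd : ∀ t : ℝ, HasDerivAt (fun _ : ℝ => (0 : ℂ × ℂ)) (v t 0) t := by
    intro t
    have : v t 0 = 0 := by rw [hv]; simp
    rw [this]; exact hasDerivAt_const t 0
  have hYx₁ : Y x₁ = 0 := by rw [hY]; simp [h0, h0']
  have hx₁ab : x₁ ∈ Icc a b := ⟨min_le_right _ _, le_max_right _ _⟩
  have hxab : x ∈ Icc a b := ⟨min_le_left _ _, le_max_left _ _⟩
  -- uniqueness to the right of x₁ and to the left of x₁
  have hright : EqOn Y (fun _ => 0) (Icc x₁ b) :=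
    ODE_solution_unique_of_mem_Icc_right (v := v) (s := fun _ => univ) (K := Real.toNNReal Kr)
      (fun t ht => hLip t ⟨hx₁ab.1.trans ht.1, ht.2.le⟩)
      (hYc.mono (Icc_subset_Icc hx₁ab.1 le_rfl))
      (fun t ht => (hYd t ⟨hx₁ab.1.trans ht.1, ht.2.le⟩).hasDerivWithinAt) (fun _ _ => mem_univ _)
      continuousOn_const (fun t _ => (hZd t).hasDerivWithinAt) (fun _ _ => mem_univ _) hYx₁
  have hleft : EqOn Y (fun _ => 0) (Icc a x₁) :=
    ODE_solution_unique_of_mem_Icc_left (v := v) (s := fun _ => univ) (K := Real.toNNReal Kr)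
      (fun t ht => hLip t ⟨ht.1.le, ht.2.trans hx₁ab.2⟩)
      (hYc.mono (Icc_subset_Icc le_rfl hx₁ab.2))
      (fun t ht => (hYd t ⟨ht.1.le, ht.2.trans hx₁ab.2⟩).hasDerivWithinAt) (fun _ _ => mem_univ _)
      continuousOn_const (fun t _ => (hZd t).hasDerivWithinAt) (fun _ _ => mem_univ _) hYx₁
  rcases le_total x₁ x with hle | hle
  · have := hright ⟨hle, hxab.2⟩
    simpa [hY] using congrArg Prod.fst this
  · have := hleft ⟨hxab.1, hle⟩
    simpa [hY] using congrArg Prod.fst this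

/-- An a.e.-even function continuous off `±λ` is even off `±λ` (plumbing). [folklore] -/
private theorem even_of_ae' {g : ℝ → ℂ} (hgc : ContinuousOn g {x | x ≠ lam ∧ x ≠ -lam})
    (hae : ∀ᵐ x : ℝ, g (-x) = g x) : EqOn (fun x => g (-x)) g {x | x ≠ lam ∧ x ≠ -lam} := by
  refine Measure.eqOn_open_of_ae_eq (ae_restrict_of_ae hae) (isOpen_S3 lam) ?_ hgc
  refine hgc.comp continuous_neg.continuousOn fun x hx => ?_
  simp only [mem_setOf_eq] at hx ⊢
  exact ⟨fun h => hx.2 (by linarith), fun h => hx.1 (by linarith)⟩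

/-- **Two a.e.-even eigenvectors of `W_sa` with the same negative eigenvalue are proportional.**
[cite: ConnesMoscovici2022, Thm 5.1 "discrete simple spectrum" (= arXiv:2112.05500 Thm 6.1, chunk p0011:L6–L10)] -/
theorem exists_smul_eq_of_eigen (lam : ℝ) (hlam : 0 < lam) {W : L2R →ₗ.[ℂ] L2R}
    (hSA : IsProlateSA lam W) {μ : ℝ} (hμ : μ < 0) {φ₁ φ₂ : L2R}
    (hev₁ : W.HasEigenvector (μ : ℂ) φ₁) (hev₂ : W.HasEigenvector (μ : ℂ) φ₂)
    (he₁ : ∀ᵐ x : ℝ, (φ₁ : ℝ → ℂ) (-x) = (φ₁ : ℝ → ℂ) x)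
    (he₂ : ∀ᵐ x : ℝ, (φ₂ : ℝ → ℂ) (-x) = (φ₂ : ℝ → ℂ) x) :
    ∃ c : ℂ, φ₂ = c • φ₁ := by
  have hS := isOpen_S3 lam
  obtain ⟨g₁, g₂, hfg₁, hfg₂, hbc₁, hbc₂, hsm₁, hsm₂, hWr⟩ :=
    exists_repr_wronskian_eq_zero lam hlam hSA μ hev₁ hev₂
  obtain ⟨hφ₁, hW₁, -⟩ := exists_repr_of_hasEigenvector hSA hev₁
  obtain ⟨hφ₂, hW₂, -⟩ := exists_repr_of_hasEigenvector hSA hev₂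
  have hu₁ : ∀ x ∈ {x : ℝ | x ≠ lam ∧ x ≠ -lam},
      HasDerivAt (fun y => pCoeff lam y * deriv g₁ y) ((qCoeff lam x - μ) * g₁ x) x :=
    fun x hx => hasDerivAt_pCoeff_mul_deriv_repr hlam hφ₁ hW₁ hfg₁ hbc₁.differentiableOn hx.1 hx.2
  have hu₂ : ∀ x ∈ {x : ℝ | x ≠ lam ∧ x ≠ -lam},
      HasDerivAt (fun y => pCoeff lam y * deriv g₂ y) ((qCoeff lam x - μ) * g₂ x) x :=
    fun x hx => hasDerivAt_pCoeff_mul_deriv_repr hlam hφ₂ hW₂ hfg₂ hbc₂.differentiableOn hx.1 hx.2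
  have hgd : ∀ (g : ℝ → ℂ), ContDiffOn ℝ ∞ g {x | x ≠ lam ∧ x ≠ -lam} →
      ∀ x ∈ {x : ℝ | x ≠ lam ∧ x ≠ -lam}, HasDerivAt g (deriv g x) x := fun g hg x hx =>
    ((hg.differentiableOn (by simp) x hx).differentiableAt (hS.mem_nhds hx)).hasDerivAt
  -- interior vanishing of both representatives
  have hint : ∀ {φ : L2R} {g : ℝ → ℂ}, W.HasEigenvector (μ : ℂ) φ →
      (∀ᵐ x : ℝ, (φ : ℝ → ℂ) (-x) = (φ : ℝ → ℂ) x) → ((φ : ℝ → ℂ) =ᵐ[volume] g) →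
      ContDiffOn ℝ ∞ g {x | x ≠ lam ∧ x ≠ -lam} → ∀ x ∈ Ioo (-lam) lam, g x = 0 := by
    intro φ g hev he hfg hsm x hx
    obtain ⟨g', hfg', -, hsm', hzero⟩ := repr_eq_zero_on_Ioo_of_neg lam hlam hSA hμ hev he
    have heq : EqOn g g' {x | x ≠ lam ∧ x ≠ -lam} :=
      Measure.eqOn_open_of_ae_eq (ae_restrict_of_ae (hfg.symm.trans hfg')) hS hsm.continuousOn
        hsm'.continuousOn
    rw [heq ⟨ne_of_lt hx.2, by intro h; rw [h] at hx; linarith [hx.1]⟩]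
    exact hzero x hx
  have hz₁ := hint hev₁ he₁ hfg₁ hsm₁
  have hz₂ := hint hev₂ he₂ hfg₂ hsm₂
  -- evenness of the representatives off ±λ
  have heven : ∀ {φ : L2R} {g : ℝ → ℂ}, (∀ᵐ x : ℝ, (φ : ℝ → ℂ) (-x) = (φ : ℝ → ℂ) x) →
      ((φ : ℝ → ℂ) =ᵐ[volume] g) → ContDiffOn ℝ ∞ g {x | x ≠ lam ∧ x ≠ -lam} →
      EqOn (fun x => g (-x)) g {x | x ≠ lam ∧ x ≠ -lam} := by
    intro φ g he hfg hsm
    have h1 : (fun x => (φ : ℝ → ℂ) (-x)) =ᵐ[volume] fun x => g (-x) :=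
      (Measure.measurePreserving_neg (volume : Measure ℝ)).quasiMeasurePreserving.ae_eq_comp hfg
    have hae : ∀ᵐ x : ℝ, g (-x) = g x := by
      filter_upwards [he, hfg, h1] with x h0 h2 h3
      rw [← h3, h0, h2]
    exact even_of_ae' hsm.continuousOn hae
  have hev_g₁ := heven he₁ hfg₁ hsm₁
  have hev_g₂ := heven he₂ hfg₂ hsm₂
  -- Cauchy data at x₁ = λ + 1
  set x₁ : ℝ := lam + 1 with hx₁
  have hx₁l : lam < x₁ := by rw [hx₁]; linarith
  have hx₁S : x₁ ∈ {x : ℝ | x ≠ lam ∧ x ≠ -lam} := ⟨ne_of_gt hx₁l, by intro h; linarith⟩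
  have hp₁ : pCoeff lam x₁ ≠ 0 := by
    rw [pCoeff, Ne, Complex.ofReal_eq_zero]; nlinarith
  have hWr₁ : pCoeff lam x₁ * deriv g₂ x₁ * g₁ x₁ - pCoeff lam x₁ * deriv g₁ x₁ * g₂ x₁ = 0 :=
    hWr x₁ (Or.inl hx₁l)
  have hW' : deriv g₂ x₁ * g₁ x₁ = deriv g₁ x₁ * g₂ x₁ := by
    have := mul_left_cancel₀ hp₁ (a := pCoeff lam x₁)
      (show pCoeff lam x₁ * (deriv g₂ x₁ * g₁ x₁) = pCoeff lam x₁ * (deriv g₁ x₁ * g₂ x₁) by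
        linear_combination hWr₁)
    exact this
  -- g₁ has nonzero Cauchy data at x₁ (else φ₁ = 0)
  have hdata : g₁ x₁ ≠ 0 ∨ deriv g₁ x₁ ≠ 0 := by
    by_contra hcon
    push Not at hcon
    have hzero : ∀ x ∈ Ioi lam, g₁ x = 0 := eq_zero_Ioi_of_prolate_ode hlam μ hsm₁ hu₁ hx₁l hcon.1 hcon.2
    have hall : ∀ x ∈ {x : ℝ | x ≠ lam ∧ x ≠ -lam}, g₁ x = 0 := by
      intro x hx
      rcases lt_trichotomy x (-lam) with h | h | h
      · rw [← hev_g₁ hx]; exact hzero (-x) (by simp only [mem_Ioi]; linarith)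
      · exact absurd h hx.2
      rcases lt_trichotomy x lam with h' | h' | h'
      · exact hz₁ x ⟨h, h'⟩
      · exact absurd h' hx.1
      · exact hzero x h'
    have hnull : ∀ᵐ x : ℝ, x ≠ lam ∧ x ≠ -lam := by
      have h1 : ∀ᵐ x : ℝ, x ≠ lam := by rw [ae_iff]; simp
      have h2 : ∀ᵐ x : ℝ, x ≠ -lam := by rw [ae_iff]; simp
      exact h1.and h2
    have hφ0 : φ₁ = 0 := by
      refine Lp.eq_zero_iff_ae_eq_zero.2 ?_
      filter_upwards [hfg₁, hnull] with x hx hxS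
      rw [hx, hall x hxS]; rfl
    exact hev₁.2 hφ0
  -- the proportionality constant
  obtain ⟨c, hc0, hc1⟩ : ∃ c : ℂ, g₂ x₁ = c * g₁ x₁ ∧ deriv g₂ x₁ = c * deriv g₁ x₁ := by
    rcases hdata with h | h
    · refine ⟨g₂ x₁ / g₁ x₁, by field_simp, ?_⟩
      field_simp
      linear_combination hW'
    · by_cases h0 : g₁ x₁ = 0
      · refine ⟨deriv g₂ x₁ / deriv g₁ x₁, ?_, by field_simp⟩
        have : deriv g₁ x₁ * g₂ x₁ = 0 := by rw [← hW', h0, mul_zero]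
        rcases mul_eq_zero.1 this with h1 | h1
        · exact absurd h1 h
        · rw [h1, h0, mul_zero]
      · refine ⟨g₂ x₁ / g₁ x₁, by field_simp, ?_⟩
        field_simp
        linear_combination hW'
  -- the difference solves the equation with zero Cauchy data, hence vanishes on (λ, ∞)
  set hdiff : ℝ → ℂ := fun x => g₂ x - c * g₁ x with hh
  have hsmh : ContDiffOn ℝ ∞ hdiff {x | x ≠ lam ∧ x ≠ -lam} := hsm₂.sub (contDiffOn_const.mul hsm₁)
  have hderivh : ∀ x ∈ {x : ℝ | x ≠ lam ∧ x ≠ -lam}, deriv hdiff x = deriv g₂ x - c * deriv g₁ x := by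
    intro x hx
    exact ((hgd g₂ hsm₂ x hx).sub ((hgd g₁ hsm₁ x hx).const_mul c)).deriv
  have huh : ∀ x ∈ {x : ℝ | x ≠ lam ∧ x ≠ -lam},
      HasDerivAt (fun y => pCoeff lam y * deriv hdiff y) ((qCoeff lam x - μ) * hdiff x) x := by
    intro x hx
    have h := (hu₂ x hx).sub ((hu₁ x hx).const_mul c)
    have hloc : (fun y => pCoeff lam y * deriv hdiff y) =ᶠ[𝓝 x]
        fun y => pCoeff lam y * deriv g₂ y - c * (pCoeff lam y * deriv g₁ y) := by
      filter_upwards [hS.mem_nhds hx] with y hy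
      rw [hderivh y hy]; ring
    refine (h.congr_of_eventuallyEq hloc).congr_deriv ?_
    rw [hh]; dsimp only; ring
  have hh0 : hdiff x₁ = 0 := by rw [hh]; dsimp only; rw [hc0]; ring
  have hh0' : deriv hdiff x₁ = 0 := by rw [hderivh x₁ hx₁S, hc1]; ring
  have hzero : ∀ x ∈ Ioi lam, hdiff x = 0 := eq_zero_Ioi_of_prolate_ode hlam μ hsmh huh hx₁l hh0 hh0'
  -- hence g₂ = c g₁ off ±λ, so a.e.
  have hall : ∀ x ∈ {x : ℝ | x ≠ lam ∧ x ≠ -lam}, g₂ x = c * g₁ x := by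
    intro x hx
    have hout : ∀ y ∈ Ioi lam, g₂ y = c * g₁ y := fun y hy => by
      have := hzero y hy; rw [hh] at this; dsimp only at this; exact sub_eq_zero.1 this
    rcases lt_trichotomy x (-lam) with h | h | h
    · rw [← hev_g₁ hx, ← hev_g₂ hx]; exact hout (-x) (by simp only [mem_Ioi]; linarith)
    · exact absurd h hx.2
    rcases lt_trichotomy x lam with h' | h' | h'
    · rw [hz₁ x ⟨h, h'⟩, hz₂ x ⟨h, h'⟩, mul_zero]
    · exact absurd h' hx.1
    · exact hout x h'
  have hnull : ∀ᵐ x : ℝ, x ≠ lam ∧ x ≠ -lam := by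
    have h1 : ∀ᵐ x : ℝ, x ≠ lam := by rw [ae_iff]; simp
    have h2 : ∀ᵐ x : ℝ, x ≠ -lam := by rw [ae_iff]; simp
    exact h1.and h2
  refine ⟨c, Lp.ext ?_⟩
  filter_upwards [hfg₁, hfg₂, hnull, Lp.coeFn_smul c φ₁] with x h1 h2 hxS hs
  rw [hs, Pi.smul_apply, smul_eq_mul, h1, h2, hall x hxS]

/-- **Connes–Moscovici 2022, Thm 5.1, first clause — for every `λ > 0`**: negative even-sector
eigenvalues of `W_sa` are simple: `dim (eigenspace μ ⊓ L²_even) ≤ 1` for `μ < 0`.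
[cite: ConnesMoscovici2022, Thm 5.1 "The operator has discrete simple spectrum" (= arXiv:2112.05500 Thm 6.1, chunk p0011:L6–L10)] -/
theorem finrank_eigenspace_inf_evenPart_le_one (lam : ℝ) (hlam : 0 < lam) {W : L2R →ₗ.[ℂ] L2R}
    (hSA : IsProlateSA lam W) {μ : ℝ} (hμ : μ < 0) :
    Module.finrank ℂ (W.eigenspace (μ : ℂ) ⊓ ConnesConsani2021.evenPart : Submodule ℂ L2R) ≤ 1 := by
  set E : Submodule ℂ L2R := W.eigenspace (μ : ℂ) ⊓ ConnesConsani2021.evenPart with hE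
  by_cases hfin : Module.Finite ℂ E
  swap
  · rw [Module.finrank_of_not_finite hfin]; exact zero_le_one
  rw [finrank_le_one_iff]
  by_cases hex : ∃ v : E, v ≠ 0
  · obtain ⟨v, hv⟩ := hex
    refine ⟨v, fun w => ?_⟩
    by_cases hw : w = 0
    · exact ⟨0, by rw [hw, zero_smul]⟩
    have hv' : (v : L2R) ≠ 0 := fun h => hv (Subtype.ext h)
    have hw' : (w : L2R) ≠ 0 := fun h => hw (Subtype.ext h)
    have hev₁ : W.HasEigenvector (μ : ℂ) (v : L2R) := ⟨v.2.1, hv'⟩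
    have hev₂ : W.HasEigenvector (μ : ℂ) (w : L2R) := ⟨w.2.1, hw'⟩
    have he₁ : ∀ᵐ x : ℝ, ((v : L2R) : ℝ → ℂ) (-x) = ((v : L2R) : ℝ → ℂ) x :=
      ConnesConsani2021.mem_evenPart_iff.1 v.2.2
    have he₂ : ∀ᵐ x : ℝ, ((w : L2R) : ℝ → ℂ) (-x) = ((w : L2R) : ℝ → ℂ) x :=
      ConnesConsani2021.mem_evenPart_iff.1 w.2.2
    obtain ⟨c, hc⟩ := exists_smul_eq_of_eigen lam hlam hSA hμ hev₁ hev₂ he₁ he₂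
    exact ⟨c, Subtype.ext (by rw [Submodule.coe_smul, ← hc])⟩
  · push Not at hex
    exact ⟨0, fun w => ⟨0, by rw [hex w, smul_zero]⟩⟩

end Literature.NumberTheory.ConnesMoscovici2022
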